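import Literature.AlgebraicGeometry.GroupSchemes.BTGroupFrobeniusKernelInCoordinates      -- ★ p845380∕p845404 (FKw): criterion, `Ker F^t = V(x^{p^t})`, ranks
import Literature.AlgebraicGeometry.GroupSchemes.ConnectedFactorsThroughUnitComponent     -- ★ `existsUnique_fac_hom`: connected `H →hom G` factors through `G⁰`
import Literature.AlgebraicGeometry.GroupSchemes.HopfIdealOfClosedSubgroup                -- ★ B-p12: `ptEquiv`, `isoSpecOver`, `ker_ptEquiv_isoSpecOver_inv_comp_eq`
import HarnessLib

/-!
# The Frobenius kernel lives in the unit component: `Ker F^t_{G∕k} = Ker F^t_{G⁰∕k}`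

Topic `Literature/AlgebraicGeometry/GroupSchemes`; namespace `Literature.AlgebraicGeometry.GroupSchemes`.  THEOREMS ONLY (no definition, no named
fact, no instance, no notation, no `sorry`).  Cell `hodgecm-mathlib` (D-0151), FLOOR 0, P6 «MOD programme» (crux hLiu418 = stmt-HodgeConjecture-24832),
organ **(FKw-ord)**, sequel of ★ (FKw) `BTGroupFrobeniusKernelInCoordinates`: at an ORDINARY point the `[ϖ]`-layer `G = 𝒢⁰[ϖ] × 𝒢^{ét}[ϖ]` of the
`w`-block is not monogenic, but its Frobenius kernel is that of the (monogenic) unit component `G⁰`; this file supplies «`Ker F^t_G = Ker F^t_{G⁰}`»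
in the tree's unit-component currency (`j : G₀ ⟶ G` a homomorphism that is an open-and-closed immersion — ★ `UnitComponentOfFiniteGroupScheme`,
`UnitComponentClopen`, `ConnectedFactorsThroughUnitComponent`) and the CARRIER forms P6c's CONSTRUCTOR-SKELETON §1∕§2 consumes (`kerF x̄ := ker Γ(ι_{Ker F^f})`
as an ideal of `Γ(G)`, «rank `q`»).  HC_CM is proved only modulo the printed citations until rung 0 closes; nothing here is about HC.

THE PRINT.  [SGA3I] VII_A 4.1–4.3: the relative Frobenius `F_{G∕k} : G → G^{(q)}` is radicial (a universal homeomorphism), so `Ker F_{G∕k}` is an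
infinitesimal (one-point, connected) closed subgroup; [Tate1997FiniteFlatGroupSchemes] (3.7): a finite group scheme over a field splits as `G⁰ × G^{ét}`
with `G⁰` the unit component, open and closed, through which every homomorphism from a connected group scheme factors; hence `Ker F_{G∕k} ⊆ G⁰` and,
since `F_{G⁰∕k}` is the restriction of `F_{G∕k}` (functoriality of `F`, [SGA3I] VII_A 4.1), `Ker F^t_{G∕k} = Ker F^t_{G⁰∕k}`.  [Demazure1972] II §7.

THE ROUTE.  §1 `Ker F^t` has ONE POINT for every separated `k`-group scheme (`F^t` is injective on points, ★ `relFrobeniusOver_base_bijective`, and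
★ (o-c3g) `subsingleton_ker_left_of_injective`), hence is connected.  §2 LAYER CRITERION for a group-scheme ambient: for `j : G₀ → G` a homomorphism
with `j.left` mono, `(c ≫ j) ≫ F^t_G = 1 ↔ c ≫ F^t_{G₀} = 1` (★ p845240's `comp_comp_relFrobenius_eq_one_iff_of_mono`, whose ambient is an abelian
variety, verbatim).  §3 `Ker F^t_{G₀} ≅ Ker F^t_G` over `j` when `j` is an open-and-closed immersion: `→` is `kerLift (ι₀ ≫ j)`, `←` factors `ι_G`
through `j` (§1 + ★ `existsUnique_fac_hom`) and lifts by §2.  §4 carriers: `ker Γ(ι_{Ker F^t_G}) = Γ(j)⁻¹ ker Γ(ι_{Ker F^t_{G₀}})`,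
`dim_k Γ(Ker F^t_G) = dim_k Γ(Ker F^t_{G₀})`, and with a monogenic unit component `Γ(G₀) ≃ₐ k[X]⧸(X^N)`: `dim_k Γ(G)⧸ker Γ(ι_{Ker F^t_G}) = min(p^t, N)`
(P6c's `hrkF` at ordinary AND supersingular points).  §5 `ker Γ(j) ≤ ker Γ(ι_{Ker F^t_G})` and its (E-b)∕(K-b) points-currency form — the SHAPE
of P6c's `stub_K1_unitIdeal_le_kerFI` (CONSTRUCTOR cand v1, F0P6c-plan (g2) deal D1 16:20:49Z), closed by one `exact`.

## References
* [SGA3I] M. Demazure, A. Grothendieck (eds.), *SGA 3, Tome I*, Exp. VII_A (P. Gabriel) §4, 4.1–4.3.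
* [Tate1997FiniteFlatGroupSchemes] J. Tate, *Finite flat group schemes*, in: Modular Forms and Fermat's Last Theorem (1997) — (3.7).
* [Demazure1972] M. Demazure, *Lectures on p-divisible groups*, LNM 302 (1972) — Ch. II §7.
* [GortzWedhorn2020] U. Görtz, T. Wedhorn, *Algebraic Geometry I* (2nd ed., 2020) — Definition 4.45 (2) (p. 117).
* [Waterhouse1979] W. C. Waterhouse, *Introduction to Affine Group Schemes*, GTM 66 (1979) — §2.1 (closed subgroups ↔ Hopf ideals).
-/

set_option autoImplicit false

noncomputable section

-- Mathlib's `Over`/`Scheme` and the transported group structures are stated across semireducible wrappers (as in ★ `GroupSchemes/*`).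
set_option backward.isDefEq.respectTransparency false

-- As in ★ (FKw): statements of the shape `c ≫ F^t = 1` need the slow `One (T ⟶ G^{(p^t)})` instance search (Mathlib's scoped `Hom.monoid`
-- through the transported structure of the twist); no proof `maxHeartbeats` budget is raised.
set_option synthInstance.maxHeartbeats 200000

open CategoryTheory CategoryTheory.Limits AlgebraicGeometry MonoidalCategory CartesianMonoidalCategory Polynomial IsLocalRing

open scoped MonObj Obj

universe u

namespace Literature.AlgebraicGeometry.GroupSchemes

open Literature.AlgebraicGeometry.Motives GroupSchemeKernel

variable {k : Type u} [Field k] (p : ℕ) [ExpChar k p] (t : ℕ)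

/-! ## §1 `Ker F^t` has one point, for every separated `k`-group scheme -/

section OnePoint

variable (G : SchemeOver k) [GrpObj G] [IsSeparated G.hom]

omit [GrpObj G] in
/-- The twist `G^{(p^t)} → Spec k` of a separated `k`-scheme is separated (base change). [cite: GortzWedhorn2020, Section (4.7)] -/
theorem isSeparated_frobeniusTwistOver_hom : IsSeparated (frobeniusTwistOver p t G).hom := by
  rw [frobeniusTwistOver_hom, twistSnd_def]
  infer_instance

/-- **`Ker F^t_{G∕k}` has ONE POINT** for every separated `k`-group scheme `G`: `F^t` is injective on points (★ `relFrobeniusOver_base_bijective`)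
and the kernel of a homomorphism injective on points over a one-point base has one point (★ `subsingleton_ker_left_of_injective`).  (No monogenic
hypothesis, unlike ★ (FKw) `subsingleton_ker_relFrobeniusOver_left`.) [cite: SGA3I, VII_A 4.1–4.3] -/
theorem subsingleton_ker_relFrobeniusOver_left' : Subsingleton ↥(ker (relFrobeniusOver p t G)).left := by
  haveI := isSeparated_frobeniusTwistOver_hom p t G
  haveI := isMonHom_relFrobeniusOver p t G
  haveI : Subsingleton ↥(Spec (.of k)) := inferInstance
  exact subsingleton_ker_left_of_injective (relFrobeniusOver p t G) (relFrobeniusOver_base_bijective p t G).1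

/-- … hence `Ker F^t_{G∕k}` is CONNECTED (one point, and nonempty: the unit). [cite: SGA3I, VII_A 4.1–4.3] -/
theorem connectedSpace_ker_relFrobeniusOver_left : ConnectedSpace ↥(ker (relFrobeniusOver p t G)).left := by
  haveI := subsingleton_ker_relFrobeniusOver_left' p t G
  haveI := isMonHom_relFrobeniusOver p t G
  exact connectedSpace_left_of_subsingleton (ker (relFrobeniusOver p t G)) η[ker (relFrobeniusOver p t G)]

end OnePoint

/-! ## §2 The layer criterion for a group-scheme ambient -/

section Layer

variable {G G₀ : SchemeOver k} [GrpObj G] [GrpObj G₀] (j : G₀ ⟶ G) [IsMonHom j]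

/-- **LAYER CRITERION** (unit-section form): for a homomorphism `j : G₀ → G` of `k`-group schemes with `j.left` a monomorphism (e.g. a closed
subgroup) and a `T`-valued point `c` of `G₀`, `(c ≫ j) ≫ F^t_G = 1 ↔ F^{abs,t}_T ≫ c = (T → Spec k) ≫ Spec Frob^t ≫ e_{G₀}` — the right-hand side
is ★ (FKw) `comp_relFrobeniusOver_eq_one_iff_unit`'s criterion for `c ≫ F^t_{G₀} = 1`: the criterion does not see the ambient group
(`e_G = e_{G₀} ≫ j`, cancel `j.left`).  (★ p845240 `AbelianVariety.comp_comp_relFrobenius_eq_one_iff_of_mono` has an abelian-variety ambient; the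
two sides are kept in different currencies here so that a declaration never elaborates the trivial morphism into two different twists.)
[cite: SGA3I, VII_A 4.1] -/
theorem comp_comp_relFrobeniusOver_eq_one_iff_unit [Mono j.left] {T : SchemeOver k} (c : T ⟶ G₀) :
    (c ≫ j) ≫ relFrobeniusOver p t G = 1 ↔
      absFrobeniusOver p t T ≫ c.left = T.hom ≫ frobSpec k p t ≫ (η[G₀] : 𝟙_ (SchemeOver k) ⟶ G₀).left := by
  have hj : (η[G] : 𝟙_ (SchemeOver k) ⟶ G).left = (η[G₀] : 𝟙_ (SchemeOver k) ⟶ G₀).left ≫ j.left := by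
    rw [← Over.comp_left, IsMonHom.one_hom]
  rw [comp_relFrobeniusOver_eq_one_iff_unit, Over.comp_left, hj]
  constructor
  · intro h
    rw [← cancel_mono j.left]
    simpa only [Category.assoc] using h
  · intro h
    rw [reassoc_of% h]

/-- Hence `(ι₀ ≫ j) ≫ F^t_G = 1` on `Ker F^t_{G₀}` — the hypothesis of `kerLift` defining `Ker F^t_{G₀} → Ker F^t_G` (also ★ (FKw)
`kerι_relFrobeniusOver_comp_comp_eq_one`, by naturality). [cite: SGA3I, VII_A 4.1] [cite: GortzWedhorn2020, Definition 4.45 (2) (p. 117)] -/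
theorem kerι_comp_comp_relFrobeniusOver_eq_one [Mono j.left] :
    (kerι (relFrobeniusOver p t G₀) ≫ j) ≫ relFrobeniusOver p t G = 1 :=
  (comp_comp_relFrobeniusOver_eq_one_iff_unit p t j _).mpr
    ((comp_relFrobeniusOver_eq_one_iff_unit p t (kerι (relFrobeniusOver p t G₀))).mp (kerι_comp _))

end Layer

/-! ## §3 `Ker F^t_{G₀} ≅ Ker F^t_G` over an open-and-closed unit component `j : G₀ ↪ G` -/

section UnitComponent

variable {G G₀ : SchemeOver k} [GrpObj G] [GrpObj G₀] [IsSeparated G.hom] (j : G₀ ⟶ G) [IsMonHom j]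
  [IsOpenImmersion j.left] [IsClosedImmersion j.left]

/-- **`Ker F^t_G ↪ G` FACTORS THROUGH THE UNIT COMPONENT**: for a homomorphism `j : G₀ → G` that is an open-and-closed immersion (a unit
component of `G`), there is a unique `v : Ker F^t_G → G₀` with `v ≫ j = ι_G` — `Ker F^t_G` is connected (§1) and `ι_G` a homomorphism
(★ `ConnectedFactorsThroughUnitComponent.existsUnique_fac_hom`). [cite: Tate1997FiniteFlatGroupSchemes, (3.7)] [cite: SGA3I, VII_A 4.1–4.3] -/
theorem existsUnique_kerι_relFrobeniusOver_fac :
    ∃! v : ker (relFrobeniusOver p t G) ⟶ G₀, v ≫ j = kerι (relFrobeniusOver p t G) := by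
  haveI := isMonHom_relFrobeniusOver p t G
  haveI := connectedSpace_ker_relFrobeniusOver_left p t G
  haveI : Nonempty ↥(𝟙_ (SchemeOver k)).left := ⟨(IsLocalRing.closedPoint k : ↥(Spec (.of k)))⟩
  exact existsUnique_fac_hom j (kerι (relFrobeniusOver p t G))

set_option maxHeartbeats 400000 in
/-- **`Ker F^t_{G₀∕k} ≅ Ker F^t_{G∕k}` OVER `j`** for a unit component `j : G₀ ↪ G` (homomorphism, open-and-closed immersion) of a separated
`k`-group scheme: the Frobenius kernel lives in the unit component and is computed there.  (`→` is `kerLift (ι₀ ≫ j)`; `←` is the factorisation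
of `ι_G` through `j` lifted to `Ker F^t_{G₀}` by the layer criterion; they are inverse because `ι_G` and `ι₀ ≫ j` are monomorphisms.)
[cite: Tate1997FiniteFlatGroupSchemes, (3.7)] [cite: SGA3I, VII_A 4.1–4.3] [cite: Demazure1972, Ch. II §7] -/
theorem exists_iso_ker_relFrobeniusOver_unitComponent :
    ∃ e : ker (relFrobeniusOver p t G₀) ≅ ker (relFrobeniusOver p t G),
      e.hom ≫ kerι (relFrobeniusOver p t G) = kerι (relFrobeniusOver p t G₀) ≫ j := by
  haveI : Mono j.left := inferInstance
  obtain ⟨v, hv, -⟩ := existsUnique_kerι_relFrobeniusOver_fac p t j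
  have hvj : (v ≫ j) ≫ relFrobeniusOver p t G = 1 := by rw [hv]; exact kerι_comp _
  have hv1 := (comp_relFrobeniusOver_eq_one_iff_unit p t v).mpr ((comp_comp_relFrobeniusOver_eq_one_iff_unit p t j v).mp hvj)
  let u : ker (relFrobeniusOver p t G₀) ⟶ ker (relFrobeniusOver p t G) :=
    kerLift (kerι (relFrobeniusOver p t G₀) ≫ j) (kerι_comp_comp_relFrobeniusOver_eq_one p t j)
  let w : ker (relFrobeniusOver p t G) ⟶ ker (relFrobeniusOver p t G₀) := kerLift v hv1
  have hu : u ≫ kerι (relFrobeniusOver p t G) = kerι (relFrobeniusOver p t G₀) ≫ j := kerLift_ι _ _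
  have hw : w ≫ kerι (relFrobeniusOver p t G₀) = v := kerLift_ι _ _
  haveI : Mono (kerι (relFrobeniusOver p t G)) := mono_kerι _
  haveI : Mono (kerι (relFrobeniusOver p t G₀)) := mono_kerι _
  haveI : Mono j := Over.mono_of_mono_left j
  haveI : Mono (kerι (relFrobeniusOver p t G₀) ≫ j) := mono_comp _ _
  refine ⟨⟨u, w, ?_, ?_⟩, hu⟩
  · rw [← cancel_mono (kerι (relFrobeniusOver p t G₀) ≫ j)]
    simp only [Category.assoc, Category.id_comp]
    rw [reassoc_of% hw, hv, hu]
  · rw [← cancel_mono (kerι (relFrobeniusOver p t G))]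
    simp only [Category.assoc, Category.id_comp]
    rw [hu, reassoc_of% hw, hv]

/-- The named comparison map `kerLift (ι₀ ≫ j) : Ker F^t_{G₀} → Ker F^t_G` is an ISOMORPHISM. [cite: Tate1997FiniteFlatGroupSchemes, (3.7)]
[cite: SGA3I, VII_A 4.1–4.3] -/
theorem isIso_kerLift_kerι_comp_unitComponent :
    IsIso (kerLift (f := relFrobeniusOver p t G) (kerι (relFrobeniusOver p t G₀) ≫ j)
      (kerι_comp_comp_relFrobeniusOver_eq_one p t j)) := by
  obtain ⟨e, he⟩ := exists_iso_ker_relFrobeniusOver_unitComponent p t j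
  have heq : e.hom = kerLift (f := relFrobeniusOver p t G) (kerι (relFrobeniusOver p t G₀) ≫ j)
      (kerι_comp_comp_relFrobeniusOver_eq_one p t j) :=
    ker_hom_ext (by rw [he, kerLift_ι])
  rw [← heq]
  infer_instance

/-! ## §4 Carrier forms: the Frobenius-kernel ideal and its colength through the unit component -/

/-- **The Frobenius-kernel IDEAL of `G` is the pull-back of that of `G⁰`**: `ker Γ(ι_{Ker F^t_G}) = Γ(j)⁻¹ (ker Γ(ι_{Ker F^t_{G₀}}))` as ideals of
`Γ(G)` (from `e ≫ ι_G = ι₀ ≫ j` with `e` an isomorphism). [cite: Tate1997FiniteFlatGroupSchemes, (3.7)] [cite: SGA3I, VII_A 4.1–4.3] -/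
theorem ker_appTop_kerι_relFrobeniusOver_eq_comap :
    RingHom.ker (kerι (relFrobeniusOver p t G)).left.appTop.hom =
      Ideal.comap j.left.appTop.hom (RingHom.ker (kerι (relFrobeniusOver p t G₀)).left.appTop.hom) := by
  obtain ⟨e, he⟩ := exists_iso_ker_relFrobeniusOver_unitComponent p t j
  haveI : IsIso e.hom.left := (inferInstance : IsIso ((Over.forget _).map e.hom))
  have hinj : Function.Injective e.hom.left.appTop.hom := (ConcreteCategory.bijective_of_isIso e.hom.left.appTop).1
  calc RingHom.ker (kerι (relFrobeniusOver p t G)).left.appTop.hom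
      = RingHom.ker (e.hom.left.appTop.hom.comp (kerι (relFrobeniusOver p t G)).left.appTop.hom) :=
        (RingHom.ker_comp_of_injective _ hinj).symm
    _ = RingHom.ker (e.hom ≫ kerι (relFrobeniusOver p t G)).left.appTop.hom := by
        rw [Over.comp_left, Scheme.Hom.comp_appTop, CommRingCat.hom_comp]
    _ = Ideal.comap j.left.appTop.hom (RingHom.ker (kerι (relFrobeniusOver p t G₀)).left.appTop.hom) := by
        rw [he, Over.comp_left, Scheme.Hom.comp_appTop, CommRingCat.hom_comp, ← RingHom.comap_ker]

variable [IsFinite G.hom]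

omit [GrpObj G] [GrpObj G₀] [IsSeparated G.hom] [IsMonHom j] [IsOpenImmersion j.left] in
include j in
/-- `G₀ → Spec k` is finite (a closed subscheme of the finite `G`). [cite: Tate1997FiniteFlatGroupSchemes, (3.7)] -/
theorem isFinite_hom_of_unitComponent : IsFinite G₀.hom := by
  rw [← Over.w j]
  infer_instance

include j in
/-- **RANKS: `dim_k Γ(Ker F^t_G) = dim_k Γ(Ker F^t_{G₀})`** (the two kernels are closed subschemes of each other through the isomorphism
of §3). [cite: Tate1997FiniteFlatGroupSchemes, (3.7)] [cite: SGA3I, VII_A 4.3] -/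
theorem finrank_alg_ker_relFrobeniusOver_eq_of_unitComponent :
    Module.finrank k (AffineGroupScheme.Alg (ker (relFrobeniusOver p t G))) =
      Module.finrank k (AffineGroupScheme.Alg (ker (relFrobeniusOver p t G₀))) := by
  haveI := isFinite_hom_of_unitComponent j
  haveI := isFinite_ker_relFrobeniusOver_hom p t (G := G)
  haveI := isFinite_ker_relFrobeniusOver_hom p t (G := G₀)
  haveI : IsAffine (ker (relFrobeniusOver p t G)).left := isAffine_of_isAffineHom (ker (relFrobeniusOver p t G)).hom
  haveI : IsAffine (ker (relFrobeniusOver p t G₀)).left := isAffine_of_isAffineHom (ker (relFrobeniusOver p t G₀)).hom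
  haveI : Module.Finite k (AffineGroupScheme.Alg (ker (relFrobeniusOver p t G))) := AffineGroupScheme.Alg.moduleFinite _
  haveI : Module.Finite k (AffineGroupScheme.Alg (ker (relFrobeniusOver p t G₀))) := AffineGroupScheme.Alg.moduleFinite _
  obtain ⟨e, -⟩ := exists_iso_ker_relFrobeniusOver_unitComponent p t j
  haveI : IsIso e.hom.left := (inferInstance : IsIso ((Over.forget _).map e.hom))
  haveI : IsIso e.inv.left := (inferInstance : IsIso ((Over.forget _).map e.inv))
  refine le_antisymm ?_ ?_
  · -- `e.inv : Ker F_G ⟶ Ker F_{G₀}` is a closed immersion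
    rw [finrank_alg_eq_finrank_quotient_ker e.inv]
    exact Submodule.finrank_quotient_le
      ((RingHom.ker e.inv.left.appTop.hom : Ideal (AffineGroupScheme.Alg (ker (relFrobeniusOver p t G₀)))).restrictScalars k)
  · rw [finrank_alg_eq_finrank_quotient_ker e.hom]
    exact Submodule.finrank_quotient_le
      ((RingHom.ker e.hom.left.appTop.hom : Ideal (AffineGroupScheme.Alg (ker (relFrobeniusOver p t G)))).restrictScalars k)

variable {N : ℕ}

include j in
/-- **COLENGTH OF `kerF` THROUGH A MONOGENIC UNIT COMPONENT: `dim_k Γ(G)⧸ker Γ(ι_{Ker F^t_G}) = min(p^t, N)`** when the unit component is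
monogenic, `Γ(G₀) ≃ₐ[k] k[X]⧸(X^N)` (`N ≠ 0`) — the rank-`q` clause of P6c's `AdmSub` for `kerF x̄` at an ORDINARY point (`N = q`, `t = f`: the whole
connected part `𝒢⁰[ϖ]` is the Frobenius kernel), and again at a supersingular one (`G₀ = G`, `N = q²`). [cite: Tate1997FiniteFlatGroupSchemes, (3.7)]
[cite: Demazure1972, Ch. II §7] [cite: SGA3I, VII_A 4.3] -/
theorem finrank_quotient_ker_appTop_kerι_relFrobeniusOver_of_unitComponent
    (ψ₀ : AffineGroupScheme.Alg G₀ ≃ₐ[k] (k[X] ⧸ Ideal.span {(X : k[X]) ^ N})) (hN : N ≠ 0) :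
    Module.finrank k (AffineGroupScheme.Alg G ⧸ RingHom.ker (kerι (relFrobeniusOver p t G)).left.appTop.hom) = min (p ^ t) N := by
  haveI := isFinite_hom_of_unitComponent j
  haveI : IsAffine G.left := isAffine_of_isAffineHom G.hom
  haveI := isClosedImmersion_kerι_relFrobeniusOver_left p t (G := G)
  rw [← finrank_alg_eq_finrank_quotient_ker (kerι (relFrobeniusOver p t G)), finrank_alg_ker_relFrobeniusOver_eq_of_unitComponent p t j]
  exact finrank_alg_ker_relFrobeniusOver p t ψ₀ hN

include j in
/-- The same in `Γ(Ker F^t_G)`-currency: `dim_k Γ(Ker F^t_G) = min(p^t, N)` for a monogenic unit component `Γ(G₀) ≃ₐ[k] k[X]⧸(X^N)`.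
[cite: Tate1997FiniteFlatGroupSchemes, (3.7)] [cite: Demazure1972, Ch. II §7] -/
theorem finrank_alg_ker_relFrobeniusOver_of_unitComponent
    (ψ₀ : AffineGroupScheme.Alg G₀ ≃ₐ[k] (k[X] ⧸ Ideal.span {(X : k[X]) ^ N})) (hN : N ≠ 0) :
    Module.finrank k (AffineGroupScheme.Alg (ker (relFrobeniusOver p t G))) = min (p ^ t) N := by
  haveI := isFinite_hom_of_unitComponent j
  rw [finrank_alg_ker_relFrobeniusOver_eq_of_unitComponent p t j]
  exact finrank_alg_ker_relFrobeniusOver p t ψ₀ hN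

include j in
/-- **At an ordinary point the Frobenius kernel IS the unit component**: if the unit component is monogenic of rank `N ≤ p^t`
(`Γ(G₀) ≃ₐ[k] k[X]⧸(X^N)`, e.g. `G₀ = 𝒢⁰[ϖ]` of rank `N = q = p^f ≤ p^t`), then `ι₀ ≫ j : G₀ → G` and `Ker F^t_G ↪ G` are closed subschemes of
the same rank, and the canonical `kerLift (ι₀ ≫ j) ≫ (Ker F^t_{G₀} ≅ …)`-free statement is: `dim_k Γ(Ker F^t_G) = dim_k Γ(G₀)`.
[cite: Tate1997FiniteFlatGroupSchemes, (3.7)] [cite: Demazure1972, Ch. II §7] -/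
theorem finrank_alg_ker_relFrobeniusOver_eq_finrank_alg_unitComponent
    (ψ₀ : AffineGroupScheme.Alg G₀ ≃ₐ[k] (k[X] ⧸ Ideal.span {(X : k[X]) ^ N})) (hN : N ≠ 0) (hNt : N ≤ p ^ t) :
    Module.finrank k (AffineGroupScheme.Alg (ker (relFrobeniusOver p t G))) = Module.finrank k (AffineGroupScheme.Alg G₀) := by
  rw [finrank_alg_ker_relFrobeniusOver_of_unitComponent p t j ψ₀ hN, min_eq_right hNt, finrank_eq_of_algEquiv_quotient_X_pow ψ₀]

end UnitComponent

/-! ## §5 `Ker F^t ⊆ G⁰` as an inequality of ideals — P6c's `stub_K1` ((E-b)∕(K-b) points currency) -/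

section IdealInequality

variable {G G₀ : SchemeOver k} [GrpObj G] [GrpObj G₀] [IsSeparated G.hom] (j : G₀ ⟶ G) [IsMonHom j]
  [IsOpenImmersion j.left] [IsClosedImmersion j.left]

/-- **`Ker F^t_G ⊆ G⁰` as ideals: `ker Γ(j) ≤ ker Γ(ι_{Ker F^t_G})`** — the ideal of the unit component is contained in the Frobenius-kernel ideal
(`ker Γ(ι_{Ker F^t_G}) = Γ(j)⁻¹ ker Γ(ι_{Ker F^t_{G₀}}) ⊇ Γ(j)⁻¹ 0`). [cite: Tate1997FiniteFlatGroupSchemes, (3.7)] [cite: SGA3I, VII_A 4.1–4.3] -/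
theorem ker_appTop_unitComponent_le_ker_appTop_kerι_relFrobeniusOver :
    RingHom.ker j.left.appTop.hom ≤ RingHom.ker (kerι (relFrobeniusOver p t G)).left.appTop.hom := by
  rw [ker_appTop_kerι_relFrobeniusOver_eq_comap p t j, RingHom.ker_eq_comap_bot]
  exact Ideal.comap_mono bot_le

/-- The same in the POINTS currency of ★ (E-b)∕(K-b) (`ker (ptEquiv G (Alg G₀) (isoSpecOver⁻¹ ≫ j))`, = `ker Γ(j)` by ★
`AffineGroupScheme.ker_ptEquiv_isoSpecOver_inv_comp_eq`): the hypothesis `hK₀` of ★ (K-b) `eq_or_etale_of_isHopfIdeal_of_stable` for `K := Ker F^t_G`.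
[cite: Tate1997FiniteFlatGroupSchemes, (3.7)] [cite: Waterhouse1979, §2.1] -/
theorem ker_ptEquiv_unitComponent_le_ker_appTop_kerι_relFrobeniusOver [IsAffine G.left] [IsAffine G₀.left] :
    RingHom.ker (AffineGroupScheme.ptEquiv G (AffineGroupScheme.Alg G₀) ((AffineGroupScheme.isoSpecOver G₀).inv ≫ j)).toRingHom ≤
      RingHom.ker (kerι (relFrobeniusOver p t G)).left.appTop.hom := by
  rw [AffineGroupScheme.ker_ptEquiv_isoSpecOver_inv_comp_eq]
  exact ker_appTop_unitComponent_le_ker_appTop_kerι_relFrobeniusOver p t j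

end IdealInequality

/-- **P6c `stub_K1` SHAPE — «the Frobenius kernel lies in the unit component»**: for a finite `k`-group scheme `G` (affine) and a unit component
`jU : U ↪ G` given as a conjunction (homomorphism ∧ open immersion ∧ closed immersion ∧ connected), the ideal of `U` in the (E-b)∕(K-b) points
currency is contained in the Frobenius-kernel ideal `ker Γ(ι_{Ker F^t_G})`.  (`G → Spec k` finite ⇒ separated; connectedness of `U` is not used.)
[cite: Tate1997FiniteFlatGroupSchemes, (3.7)] [cite: SGA3I, VII_A 4.1–4.3] -/
theorem ker_ptEquiv_le_ker_appTop_kerι_relFrobeniusOver_of_unitComponent (G : SchemeOver k) [GrpObj G] [IsAffine G.left] [IsFinite G.hom]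
    (U : SchemeOver k) [GrpObj U] [IsAffine U.left] (jU : U ⟶ G)
    (hU : IsMonHom jU ∧ IsOpenImmersion jU.left ∧ IsClosedImmersion jU.left ∧ ConnectedSpace ↥U.left) :
    RingHom.ker (AffineGroupScheme.ptEquiv G (AffineGroupScheme.Alg U) ((AffineGroupScheme.isoSpecOver U).inv ≫ jU)).toRingHom ≤
      RingHom.ker (kerι (relFrobeniusOver p t G)).left.appTop.hom := by
  obtain ⟨h₁, h₂, h₃, -⟩ := hU
  haveI := h₁; haveI := h₂; haveI := h₃
  haveI : IsSeparated G.hom := inferInstance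
  exact ker_ptEquiv_unitComponent_le_ker_appTop_kerι_relFrobeniusOver p t jU

end Literature.AlgebraicGeometry.GroupSchemes

end
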